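import Summits.QuantumFields.BalabanUV.Beta.GAN24.ThirdJetKernel
import Summits.QuantumFields.BalabanUV.Beta.ValueJetGeneric

/-!
# `BalabanUV.Beta.GAN24.CubicReadoutDecLift` — binder row G-an2-4 / (CONV-C), S-slot on the RECURSIVE wall family (row (E) of the row owner's
# `SLOT-COVERAGE.md`; literal of record for binder row D1 since an2's X-an2-51, `RowD1JointEnd.JsRowD1`): THE GENERIC DECIMATION–LIFT EXCHANGE
# FOR THE CUBIC READ-OUT — every member of a value-function third-jet RECURSION through the decimated composite resolvent `KInvStep Lc j` IS a
# ONE-SHOT level-`(j+1)` `e3OfS` sandwich of the contour-summed, averaging-lifted previous stencil family (unit `b2b-balaban-gan24-p1`, gen 12;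
# `HOME/b2b-balaban-gan24-p1/S-REC-SIZING.md` v1 §2′, brick (T2-a) of route (E-α))

NOT IN PRINT; OUR BOOKKEEPING.  HONEST FRAMING (cell contract, verbatim): «discharging `BetaPertH` makes Bałaban's UV stability UNCONDITIONAL —
a real constructive-QFT result; it is NOT the continuum limit and NOT the Clay problem.»  HONEST DEPENDENCY (verbatim): «continuum YM on T⁴ ⇐
BetaPertH ∧ nine spine estimates (0/9 proved); BetaPertH ⇐ (D1) ∧ (D4) ∧ CAP+tail; G-an2-4 gates asym, D1 and NE2/3/4.»  [folklore] identities over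
tree theorems BY NAME — an4's stencil-index swap `DecLiftAdjoint.vertexOfK_borderSum` and `vertexOfK_avgLift` (I1), an2's sandwich identity
`InterLevelTransport.dec_comp_avgLift_comp` (I2), `BalabanStepJetsSucc.mmRead_eq_dec` (I3), leaf-05's generic functional `ThirdJetKernel.e3K`
(`= E3UnitSplit.e3OfS` at `K = KInv N`, `e3OfS_eq_e3K`; `=` an2's `SpineRooted.e3OfK` with the arguments swapped, `e3OfK_eq_e3K` below, `rfl`).
Generic `d`, generic kernel `K`, generic blocking factors; NO estimate, NO constant chosen, NO cited fact, NO `def`, NO `def … : Prop`, NO wall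
binder; the reserved families `GAN24.StencilSlotE3*` / `GAN24.WSlotT2*` are untouched.  Discharges NOTHING of (hS, hSall) on (E); NOT BetaPertH,
NOT continuum, NOT Clay.  It generalises leaf-05's `TopBorderKSlot.e3OfS_borderInc_top` (the SAME exchange for the one specific border piece
`borderInc = borderSum ∘ (mfNeg ∘ vhS)` of an2's composite family) to an ARBITRARY local level-`M` stencil family — which is what the recursive
family needs, whose level-`(j+1)` cubic sector `e3OfK Lc G_j (SrecAt … j)` (`WardLocusRecursive.SrecAt_succ`, `SpineRecursiveW.SpureRecAt`)
feeds the WHOLE previous stencil, not one fixed table, into the functional.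

## The finding (kernel-checked below; `N′ = M·L`, `K` decaying, `S` a local stencil family on the level-`M` lattice)
  `e3K K N′ (borderSum M S) κ′ u′ = M^{d+2} • e3K (dec M K) L S κ′ u′`                                   (`e3K_borderSum`)
equivalently `e3K (dec M K) L S κ′ u′ = e3K K N′ ((M^{d+2})⁻¹ • borderSum M S) κ′ u′` (`e3K_dec`), and at Bałaban's sockets
(`K = KInv (Lc^(j+1))`, `M = Lc^j`, `L = Lc`, `dec M (KInv N′) = KInvStep Lc j` by `rfl`):
  `e3OfK Lc (KInvStep Lc j) S κ′ u′ = e3OfS (Lc^(j+1)) (((Lc^j)^{d+2})⁻¹ • borderSum (Lc^j) S) κ′ u′`     (`e3OfK_KInvStep_eq_e3OfS`).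
READING (bookkeeping, not a claim about (E)'s estimates): the ONE-STEP cubic read-out through the UNDRESSED model step resolvent of ANY level-`j`
stencil family is the ONE-SHOT level-`(j+1)` cubic read-out — road S3's outer object, the `e3OfS N (·)` sandwich with `KInv N`'s own legs — of the
lifted family `(Lc^j)^{−(d+2)} • borderSum (Lc^j) S`; so S3's OUTER calculus (`ThirdJetKernel` §2–§5: shape, Lipschitz in the kernel, units, the
K-slot families) applies to the recursion member by member with `K := KInv (Lc^(j+1))`, and what (E)'s S-slot needs beyond it is the j-UNIFORM
control of the INNER lifted stencils (route (E-β)) or their identification with the composite family's pushed tables (route (E-α): by an5's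
`ResolventComposition.k1b'` / the swarm's `RespStepSemigroup.respStep_semigroup` the `ℋ`-weights compose exactly).  The CO-DRESSED kernel
`coDressKBmAt ρ Lc (KInvStep Lc j)` of (E) is NOT treated in this file (its `mm`-rows are those of `KInvStep`, `AxialDressingRooted.mmRead_coDressKBmAt`;
the dressing then sits on the inner vertex — a separate module).

## Contents ([folklore]; generic `d`)
§1 `e3OfK_eq_e3K` (`rfl` bridge an2 ↔ leaf-05), `mmRead_mul` (reading at the `(M·L)`-coarse points = reading the `M`-read at the `L`-coarse points),
   `bdd_of_locStencil` (a local stencil family is bounded by its constant).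
§2 **`e3K_borderSum`** (the exchange), `e3K_dec` (normalised form), `e3K_dec'` (with the product `N′ = M·L` as a hypothesis).
§3 Bałaban's sockets: **`e3OfK_KInvStep_eq_e3OfS`**, `e3OfS_borderSum_eq_e3OfK_KInvStep`, `e3K_KInvStep_eq_e3OfS`.
-/

noncomputable section

open Finset
open scoped BigOperators
open Literature.MathematicalPhysics.QuantumFieldTheory
open Literature.MathematicalPhysics.QuantumFieldTheory.Balaban1983to89
open Literature.MathematicalPhysics.QuantumFieldTheory.Balaban1983to89.Beta
open B12Sec2to5 (l1 l1_nonneg)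
open ExpKernelCalculus (MKer Decays BiLoc VertexFamily comp)
open OneStepResolventKernel (Fib LocStencil KInv decays_KInv)
open OneStepKernelFamily (dec KInvStep decays_dec vertexOfK vertexFamily_vertexOfK')
open BalabanStepJetsSucc (mmRead mmRead_inl_inl mmRead_inr_left mmRead_inr_right mmRead_eq_dec)
open InterLevelTransport (avgLift dec_comp_avgLift_comp)
open DecLiftAdjoint (borderSum vertexOfK_borderSum vertexOfK_avgLift)
open KernelWard (Bdd bdd_of_biLoc)
open Summit.QuantumFields.BalabanUV.Beta.GAN24.E3UnitSplit (e3OfS)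
open Summit.QuantumFields.BalabanUV.Beta.GAN24.ThirdJetKernel (e3K e3OfS_eq_e3K e3K_inl_inl e3K_inr_left e3K_inr_right e3K_smul
  mmRead_smul)
open Summit.QuantumFields.BalabanUV.Beta.SpineRooted (e3OfK)

namespace Summit.QuantumFields.BalabanUV.Beta.GAN24.CubicReadoutDecLift

variable {d : ℕ}

/-! ## §1 Bridges -/

/-- [folklore] an2's `SpineRooted.e3OfK L K S` and leaf-05's `ThirdJetKernel.e3K K L S` are the same functional (argument order only). -/
theorem e3OfK_eq_e3K (L : ℕ) (K : MKer (d + 1) (Fib d)) (S : Fin (d + 1) → (Fin (d + 1) → ℤ) → MKer (d + 1) (Fib d))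
    (κ' : Fin (d + 1)) (u' : Fin (d + 1) → ℤ) : e3OfK L K S κ' u' = e3K K L S κ' u' := rfl

/-- [folklore] Reading the `mm`-block at the `(M·L)`-coarse points is reading it at the `M`-coarse points of the `L`-dilated arguments
(`(M·L) • x = M • (L • x)`; generic form of `TopBorderKSlot.mmRead_pow_succ`). -/
theorem mmRead_mul (M L : ℕ) (F : MKer (d + 1) (Fib d)) (x z : Fin (d + 1) → ℤ) (a b : Fib d) :
    mmRead (M * L) F x z a b = mmRead M F ((L : ℤ) • x) ((L : ℤ) • z) a b := by
  have hsm : ∀ y : Fin (d + 1) → ℤ, (((M * L : ℕ) : ℤ)) • y = ((M : ℕ) : ℤ) • ((L : ℤ) • y) := by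
    intro y
    rw [smul_smul, Nat.cast_mul]
  rcases a with α | μ <;> rcases b with β | ν
  · rw [mmRead_inl_inl, mmRead_inl_inl, hsm x, hsm z]
  · simp only [mmRead_inr_right]
  · simp only [mmRead_inr_left]
  · simp only [mmRead_inr_left]

/-- [folklore] A local stencil family is bounded by its constant (`KernelWard.bdd_of_biLoc` member by member). -/
theorem bdd_of_locStencil {S : Fin (d + 1) → (Fin (d + 1) → ℤ) → MKer (d + 1) (Fib d)} {Cs δ : ℝ} (hS : LocStencil S Cs δ)
    (hδ : 0 ≤ δ) : ∀ κ z x w a b, |S κ z x w a b| ≤ Cs :=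
  fun κ z x w a b => bdd_of_biLoc (hS κ z) hδ x w a b

/-! ## §2 The exchange -/

section Exchange

variable {K : MKer (d + 1) (Fib d)} {C δK : ℝ} {S : Fin (d + 1) → (Fin (d + 1) → ℤ) → MKer (d + 1) (Fib d)} {Cs δ : ℝ}
  {M L N' : ℕ} [NeZero M]

/-- [folklore] **THE DECIMATION–LIFT EXCHANGE FOR THE CUBIC READ-OUT** (exact, entrywise; `N′ = M·L`): for a decaying fine kernel `K` and a
local stencil family `S` on the `M`-times coarser lattice, the cubic read-out at blocking `N′` THROUGH `K` of the `M`-contour-summed lifted family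
`borderSum M S` is `M^{d+2}` times the cubic read-out at blocking `L` THROUGH THE DECIMATED KERNEL `dec M K` of `S` itself:
`e3K K N′ (borderSum M S) κ′ u′ = M^{d+2} • e3K (dec M K) L S κ′ u′`.  Mechanism: the vertex leg of `K` meets a table lifted from level `M`, so
it enters only through the `M`-decimated column ((I1) `DecLiftAdjoint.vertexOfK_borderSum`, `vertexOfK_avgLift`; the factor `M^{d+2}` = legs of
one level-`M` bond summed with weight one vs the mean weight of `dec`); the two outer multiplier legs are read at `N′•x = M•(L•x)` (`mmRead_mul`,
(I3) `mmRead_eq_dec`) and the lift is adjoint to decimation inside the sandwich ((I2) `InterLevelTransport.dec_comp_avgLift_comp`; Fubini from the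
decay of `K` and the bi-localisation of the step vertex, `vertexFamily_vertexOfK'` ∘ `decays_dec`). -/
theorem e3K_borderSum (hK : Decays K C δK) (hδK : 0 < δK) (hS : LocStencil S Cs δ) (hδ : 0 < δ) (hN : N' = M * L)
    (κ' : Fin (d + 1)) (u' : Fin (d + 1) → ℤ) :
    e3K K N' (borderSum M S) κ' u' = ((M : ℝ) ^ (d + 2)) • e3K (dec M K) L S κ' u' := by
  subst hN
  have hM : 1 ≤ M := Nat.one_le_iff_ne_zero.2 (NeZero.ne M)
  have hC : 0 ≤ C := hK.nonneg (Sum.inl 0)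
  -- the decimated kernel decays (same rate)
  have hdK := decays_dec hK hC hδK.le hM
  -- the step vertex through `dec M K` is bi-localised (for (I2)'s Fubini)
  obtain ⟨Cv, δv, hδv, hV⟩ :=
    vertexFamily_vertexOfK' (N := L) ⟨δK, C * Real.exp (δK * (4 * (d + 1) * M)), hδK, by positivity, hdK⟩ hS hδ
  have hSb : ∀ κ z x w a b, |S κ z x w a b| ≤ Cs := bdd_of_locStencil hS hδ.le
  funext x z a b
  simp only [Pi.smul_apply, smul_eq_mul]
  rcases a with α | μ
  · rcases b with β | ν
    · -- field–field block: the located identity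
      show -(mmRead (M * L) (comp (comp K (vertexOfK K (M * L) (borderSum M S) κ' u')) K) x z (Sum.inl α) (Sum.inl β)) = _
      rw [vertexOfK_borderSum (Lc := L) hK hδK hSb rfl κ' u', vertexOfK_avgLift hdK hδK L M hSb κ' u',
        KernelReflection.comp_smul_right, KernelReflection.comp_smul_left, mmRead_smul, Pi.smul_apply, Pi.smul_apply, Pi.smul_apply,
        Pi.smul_apply, smul_eq_mul, mmRead_mul, mmRead_eq_dec, dec_comp_avgLift_comp M hK hδK.le hK hδK.le (hV κ' u') hδv, e3K_inl_inl,
        mul_neg]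
    · simp only [e3K_inr_right, mul_zero]
  · simp only [e3K_inr_left, mul_zero]

/-- [folklore] **NORMALISED FORM**: the step read-out through the decimated kernel IS the one-shot read-out through `K` of the MEAN-WEIGHT lifted
family `(M^{d+2})⁻¹ • borderSum M S` (`e3K_borderSum` + `ThirdJetKernel.e3K_smul`). -/
theorem e3K_dec (hK : Decays K C δK) (hδK : 0 < δK) (hS : LocStencil S Cs δ) (hδ : 0 < δ) (hN : N' = M * L)
    (κ' : Fin (d + 1)) (u' : Fin (d + 1) → ℤ) :
    e3K (dec M K) L S κ' u' = e3K K N' (fun κ z => (((M : ℝ) ^ (d + 2))⁻¹) • borderSum M S κ z) κ' u' := by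
  have hM : ((M : ℝ) ^ (d + 2)) ≠ 0 := pow_ne_zero _ (by exact_mod_cast NeZero.ne M)
  rw [e3K_smul, e3K_borderSum hK hδK hS hδ hN, smul_smul, inv_mul_cancel₀ hM, one_smul]

end Exchange

/-! ## §3 Bałaban's sockets: every step read-out through `KInvStep Lc j` is a one-shot `e3OfS` at level `j+1` -/

section Balaban

variable {Lc : ℕ} [NeZero Lc] {S : Fin (d + 1) → (Fin (d + 1) → ℤ) → MKer (d + 1) (Fib d)} {Cs δ : ℝ}

/-- [folklore] **THE ONE-STEP CUBIC READ-OUT THROUGH THE DECIMATED COMPOSITE RESOLVENT IS A ONE-SHOT `e3OfS` SANDWICH ONE LEVEL UP**: for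
ANY local stencil family `S` on the step-`j` lattice,
`e3OfK Lc (KInvStep Lc j) S κ′ u′ = e3OfS (Lc^(j+1)) (((Lc^j)^{d+2})⁻¹ • borderSum (Lc^j) S) κ′ u′`
(`e3K_dec` at `K := KInv (Lc^(j+1))`, `M := Lc^j`, `L := Lc`; `dec (Lc^j) (KInv (Lc^(j+1))) = KInvStep Lc j` and `e3OfS = e3K (KInv ·)` by `rfl` /
`ThirdJetKernel.e3OfS_eq_e3K`).  Member `j+1` of any `e3OfK`-recursion through the undressed model step resolvents is thus road S3's OUTER object. -/
theorem e3OfK_KInvStep_eq_e3OfS (hS : LocStencil S Cs δ) (hδ : 0 < δ) (j : ℕ) (κ' : Fin (d + 1)) (u' : Fin (d + 1) → ℤ) :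
    e3OfK Lc (KInvStep (d := d) Lc j) S κ' u'
      = e3OfS (Lc ^ (j + 1)) (fun κ z => ((((Lc : ℝ) ^ j) ^ (d + 2))⁻¹) • borderSum (Lc ^ j) S κ z) κ' u' := by
  obtain ⟨δK, CK, hδK, _, hK⟩ := decays_KInv (N := Lc ^ (j + 1)) (d := d)
  have hdec : dec (Lc ^ j) (KInv (N := Lc ^ (j + 1)) (d := d)) = KInvStep (d := d) Lc j := rfl
  have h := e3K_dec (L := Lc) hK hδK hS hδ (pow_succ Lc j) κ' u'
  rw [hdec, Nat.cast_pow] at h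
  rw [e3OfS_eq_e3K, e3OfK_eq_e3K]
  exact h

/-- [folklore] The same exchange read from the one-shot side with the weight-one lift:
`e3OfS (Lc^(j+1)) (borderSum (Lc^j) S) κ′ u′ = (Lc^j)^{d+2} • e3OfK Lc (KInvStep Lc j) S κ′ u′`. -/
theorem e3OfS_borderSum_eq_e3OfK_KInvStep (hS : LocStencil S Cs δ) (hδ : 0 < δ) (j : ℕ) (κ' : Fin (d + 1))
    (u' : Fin (d + 1) → ℤ) :
    e3OfS (Lc ^ (j + 1)) (borderSum (Lc ^ j) S) κ' u' = (((Lc : ℝ) ^ j) ^ (d + 2)) • e3OfK Lc (KInvStep (d := d) Lc j) S κ' u' := by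
  obtain ⟨δK, CK, hδK, _, hK⟩ := decays_KInv (N := Lc ^ (j + 1)) (d := d)
  have hdec : dec (Lc ^ j) (KInv (N := Lc ^ (j + 1)) (d := d)) = KInvStep (d := d) Lc j := rfl
  have h := e3K_borderSum (L := Lc) hK hδK hS hδ (pow_succ Lc j) κ' u'
  rw [hdec, Nat.cast_pow] at h
  rw [e3OfS_eq_e3K, e3OfK_eq_e3K]
  exact h

/-- [folklore] The exchange in leaf-05's spelling on both sides (`e3K (KInvStep Lc j) Lc S` = the top rows' object of `TopBorderKSlot`). -/
theorem e3K_KInvStep_eq_e3OfS (hS : LocStencil S Cs δ) (hδ : 0 < δ) (j : ℕ) (κ' : Fin (d + 1)) (u' : Fin (d + 1) → ℤ) :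
    e3K (KInvStep (d := d) Lc j) Lc S κ' u'
      = e3OfS (Lc ^ (j + 1)) (fun κ z => ((((Lc : ℝ) ^ j) ^ (d + 2))⁻¹) • borderSum (Lc ^ j) S κ z) κ' u' :=
  e3OfK_KInvStep_eq_e3OfS hS hδ j κ' u'

end Balaban

end Summit.QuantumFields.BalabanUV.Beta.GAN24.CubicReadoutDecLift

end
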